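import Mathlib
import Literature.Analysis.PDE.Wave1DExteriorEnergy
import HarnessLib

/-!
# Near-edge channel of energy, I: lemmas (Peter–Paul, exponential `L¹` bound, source smallness,
# and a `liminf` bookkeeping lemma)

Analysis/PDE support file (everything proved), first half of the forward near-edge channel lower
bound `Wave1DNearChannelForward.lean` for `ψ_tt − ψ_xx + V(x)ψ = 0` with a potential that is
exponentially small to the left of the edge `a`, `0 ≤ V(x) ≤ K e^{μ(x−a)}` (`x ≤ a`):

* `add_sq_ge_div_sub_div` — `(u+v)² ≥ u²/(1+η) − v²/η`;
* `integral_exp_neg_half_le` — `∫_0^t e^{−μτ/2} ≤ 2/μ`;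
* `contDiff_two_slices` — slices of `C²` functions of two variables;
* `wave1D_sqrt_source_sq_le` / `wave1D_integral_sqrt_source_sq_le` — SOURCE SMALLNESS: for a global
  `C²` solution `φ` whose data have `V`-energy `≤ EV` on `(−∞, a]`, on the slices of the truncated
  trapezoid `{b + τ ≤ x ≤ a − τ}` one has `√(∫ (Vφ)²) ≤ √K e^{−μτ/2} √EV`, hence
  `∫_0^t √(∫ (Vφ)²) dτ ≤ (2√K/μ) √EV` (energy monotonicity + `sup V ≤ K e^{−μτ}` on the slice);
* `ENNReal.ofReal_le_liminf_of_truncated` — bookkeeping: lower bounds on truncations that converge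
  as the truncation is removed, up to a term tending to `0` in time, give a `liminf` lower bound.

Folklore.
-/

noncomputable section

namespace Literature.Analysis.PDE

open MeasureTheory Set Filter Topology intervalIntegral Literature.Analysis.Calculus

/-- Peter–Paul form of `(u+v)²`: `(u + v)² ≥ u²/(1+η) − v²/η` for `η > 0`. [folklore] -/
theorem add_sq_ge_div_sub_div (u v : ℝ) {η : ℝ} (hη : 0 < η) :
    u ^ 2 / (1 + η) - v ^ 2 / η ≤ (u + v) ^ 2 := by
  have h1 : 0 < 1 + η := by linarith
  rw [div_sub_div _ _ h1.ne' hη.ne', div_le_iff₀ (mul_pos h1 hη)]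
  nlinarith [sq_nonneg (η * (u + v) + v), sq_nonneg (η * u - v), hη, h1, sq_nonneg (u + v),
    mul_pos h1 hη, sq_nonneg (η * (u + v) - (u - 0)), sq_nonneg ((1 + η) * v + η * u)]

/-- `∫_0^t e^{−μτ/2} dτ ≤ 2/μ` for `μ > 0` (any `t`). [folklore] -/
theorem integral_exp_neg_half_le {μ : ℝ} (hμ : 0 < μ) (t : ℝ) :
    ∫ τ in (0 : ℝ)..t, Real.exp (-(μ * τ) / 2) ≤ 2 / μ := by
  have hder : ∀ τ, HasDerivAt (fun τ => -(2 / μ) * Real.exp (-(μ * τ) / 2))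
      (Real.exp (-(μ * τ) / 2)) τ := by
    intro τ
    have hlin : HasDerivAt (fun τ => -(μ * τ) / 2) (-μ / 2) τ := by
      simpa using (((hasDerivAt_id τ).const_mul μ).neg).div_const 2
    have := (hlin.exp).const_mul (-(2 / μ))
    refine this.congr_deriv ?_
    field_simp
  rw [integral_eq_sub_of_hasDerivAt (fun τ _ => hder τ)
    ((Real.continuous_exp.comp (by fun_prop)).intervalIntegrable _ _)]
  have h1 : 0 < Real.exp (-(μ * t) / 2) := Real.exp_pos _
  have h2 : Real.exp (-(μ * 0) / 2) = 1 := by simp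
  rw [h2]
  have : -(2 / μ) * Real.exp (-(μ * t) / 2) - -(2 / μ) * 1 = (2 / μ) * (1 - Real.exp (-(μ * t) / 2)) := by
    ring
  rw [this]
  have h3 : 0 < 2 / μ := by positivity
  nlinarith

/-- Slices of a `C²` function of two variables are `C²`. [folklore] -/
theorem contDiff_two_slices {φ : ℝ → ℝ → ℝ} (hφ : ContDiff ℝ 2 (Function.uncurry φ)) (t x : ℝ) :
    ContDiff ℝ 2 (fun τ => φ τ x) ∧ ContDiff ℝ 2 (φ t) := by
  constructor
  · exact hφ.comp (contDiff_id.prodMk contDiff_const)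
  · exact hφ.comp (contDiff_const.prodMk contDiff_id)


section Source

variable {V : ℝ → ℝ} {φ : ℝ → ℝ → ℝ}

/-- **Source smallness on a slice.** Let `φ` be a global `C²` solution of `φ_tt − φ_xx + Vφ = 0`
(`V ≥ 0` continuous, `V ≤ K e^{μ(x−a)}` on `x ≤ a`, `K ≥ 0`, `μ > 0`) whose data density is integrable
on `(−∞, a]` with integral `EV`. Then for `0 ≤ τ`, `b + τ ≤ a − τ`:
`√(∫_{b+τ}^{a−τ} (V φ(τ,·))²) ≤ √K e^{−μτ/2} √EV`. [folklore] -/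
theorem wave1D_sqrt_source_sq_le (hV : Continuous V) (hV0 : ∀ x, 0 ≤ V x) {a K μ : ℝ}
    (hK : 0 ≤ K) (hμ : 0 < μ) (hVK : ∀ x ≤ a, V x ≤ K * Real.exp (μ * (x - a)))
    (hφ : ContDiff ℝ 2 (Function.uncurry φ))
    (hφsol : ∀ t x, iteratedDeriv 2 (fun τ => φ τ x) t - iteratedDeriv 2 (φ t) x + V x * φ t x = 0)
    (hEi : IntegrableOn (fun x => deriv (fun τ => φ τ x) 0 ^ 2 + deriv (φ 0) x ^ 2
      + V x * φ 0 x ^ 2) (Iic a))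
    {τ b : ℝ} (hτ : 0 ≤ τ) (hτab : b + τ ≤ a - τ) :
    Real.sqrt (∫ x in (b + τ)..(a - τ), (-(V x * φ τ x)) ^ 2)
      ≤ Real.sqrt K * Real.exp (-(μ * τ) / 2) * Real.sqrt (∫ x in Iic a,
          (deriv (fun τ => φ τ x) 0 ^ 2 + deriv (φ 0) x ^ 2 + V x * φ 0 x ^ 2)) := by
  set EV : ℝ := ∫ x in Iic a, (deriv (fun τ => φ τ x) 0 ^ 2 + deriv (φ 0) x ^ 2
    + V x * φ 0 x ^ 2) with hEV
  have hdens_nn : ∀ x, 0 ≤ deriv (fun τ => φ τ x) 0 ^ 2 + deriv (φ 0) x ^ 2 + V x * φ 0 x ^ 2 :=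
    fun x => wave1D_energyDensity_nonneg hV0 0 x
  -- `∫ V φ² ≤ EV` on the slice (energy monotonicity for the homogeneous solution `φ`)
  have hmono := wave1D_trapezoid_energy_mono hV hV0 hφ hφsol (a := b) (b := a) (s := 0) hτ hτab
  simp only [add_zero, sub_zero] at hmono
  have hbase : (∫ x in b..a, (deriv (fun τ => φ τ x) 0 ^ 2 + deriv (φ 0) x ^ 2
      + V x * φ 0 x ^ 2)) ≤ EV := by
    rw [intervalIntegral.integral_of_le (by linarith), hEV]
    exact setIntegral_mono_set hEi (ae_of_all _ hdens_nn) (ae_of_all _ Ioc_subset_Iic_self)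
  have cφτ : Continuous fun x => φ τ x := hφ.continuous.comp (continuous_const.prodMk continuous_id)
  have hVφ : (∫ x in (b + τ)..(a - τ), V x * φ τ x ^ 2)
      ≤ ∫ x in (b + τ)..(a - τ), (deriv (fun σ' => φ σ' x) τ ^ 2 + deriv (φ τ) x ^ 2
        + V x * φ τ x ^ 2) := by
    refine intervalIntegral.integral_mono_on hτab ((hV.mul (cφτ.pow 2)).intervalIntegrable _ _)
      (((continuous_wave1D_energyDensity hV hφ).comp
        (continuous_const.prodMk continuous_id)).intervalIntegrable _ _) fun x _ => ?_
    nlinarith [sq_nonneg (deriv (fun σ' => φ σ' x) τ), sq_nonneg (deriv (φ τ) x)]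
  have hsrc : (∫ x in (b + τ)..(a - τ), (-(V x * φ τ x)) ^ 2)
      ≤ K * Real.exp (-(μ * τ)) * ∫ x in (b + τ)..(a - τ), V x * φ τ x ^ 2 := by
    rw [← intervalIntegral.integral_const_mul]
    refine intervalIntegral.integral_mono_on hτab (((hV.mul cφτ).neg.pow 2).intervalIntegrable _ _)
      (((hV.mul (cφτ.pow 2)).const_mul _).intervalIntegrable _ _) fun x hx => ?_
    have hxa : x ≤ a - τ := hx.2
    have hVx : V x ≤ K * Real.exp (-(μ * τ)) := by
      refine (hVK x (by linarith)).trans (mul_le_mul_of_nonneg_left ?_ hK)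
      refine Real.exp_le_exp.2 ?_
      have := mul_le_mul_of_nonneg_left (show x - a ≤ -τ by linarith) hμ.le
      linarith
    have hV0x := hV0 x
    nlinarith [mul_le_mul_of_nonneg_right hVx (mul_nonneg hV0x (sq_nonneg (φ τ x)))]
  have hKe : 0 ≤ K * Real.exp (-(μ * τ)) := mul_nonneg hK (Real.exp_pos _).le
  calc Real.sqrt (∫ x in (b + τ)..(a - τ), (-(V x * φ τ x)) ^ 2)
      ≤ Real.sqrt (K * Real.exp (-(μ * τ)) * EV) := by
        refine Real.sqrt_le_sqrt (hsrc.trans ?_)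
        exact mul_le_mul_of_nonneg_left (hVφ.trans (hmono.trans hbase)) hKe
    _ = Real.sqrt K * Real.exp (-(μ * τ) / 2) * Real.sqrt EV := by
        rw [Real.sqrt_mul hKe, Real.sqrt_mul hK, Real.exp_half]

/-- **Source smallness in `L¹_t L²_x` over the truncated trapezoid**: under the hypotheses of
`wave1D_sqrt_source_sq_le`, for `0 ≤ t`, `b + t ≤ a − t`:
`∫_0^t √(∫_{b+τ}^{a−τ} (Vφ)²) dτ ≤ (2√K/μ) √EV`. [folklore] -/
theorem wave1D_integral_sqrt_source_sq_le (hV : Continuous V) (hV0 : ∀ x, 0 ≤ V x) {a K μ : ℝ}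
    (hK : 0 ≤ K) (hμ : 0 < μ) (hVK : ∀ x ≤ a, V x ≤ K * Real.exp (μ * (x - a)))
    (hφ : ContDiff ℝ 2 (Function.uncurry φ))
    (hφsol : ∀ t x, iteratedDeriv 2 (fun τ => φ τ x) t - iteratedDeriv 2 (φ t) x + V x * φ t x = 0)
    (hEi : IntegrableOn (fun x => deriv (fun τ => φ τ x) 0 ^ 2 + deriv (φ 0) x ^ 2
      + V x * φ 0 x ^ 2) (Iic a))
    {t b : ℝ} (ht : 0 ≤ t) (htab : b + t ≤ a - t) :
    (∫ τ in (0 : ℝ)..t, Real.sqrt (∫ x in (b + τ)..(a - τ), (-(V x * φ τ x)) ^ 2))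
      ≤ 2 * Real.sqrt K / μ * Real.sqrt (∫ x in Iic a,
          (deriv (fun τ => φ τ x) 0 ^ 2 + deriv (φ 0) x ^ 2 + V x * φ 0 x ^ 2)) := by
  set EV : ℝ := ∫ x in Iic a, (deriv (fun τ => φ τ x) 0 ^ 2 + deriv (φ 0) x ^ 2
    + V x * φ 0 x ^ 2) with hEV
  have hFw_cont : Continuous (Function.uncurry fun τ x => -(V x * φ τ x)) := by
    show Continuous fun p : ℝ × ℝ => -(V p.2 * φ p.1 p.2)
    exact ((hV.comp continuous_snd).mul hφ.continuous).neg
  have hk_cont : Continuous fun τ => Real.sqrt (∫ x in (b + τ)..(a - τ), (-(V x * φ τ x)) ^ 2) := by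
    refine Real.continuous_sqrt.comp ?_
    have hF2 : Continuous (Function.uncurry fun τ x => (-(V x * φ τ x)) ^ 2) := by
      show Continuous fun p : ℝ × ℝ => (-(V p.2 * φ p.1 p.2)) ^ 2
      exact (show Continuous fun p : ℝ × ℝ => -(V p.2 * φ p.1 p.2) from hFw_cont).pow 2
    have hP := intervalIntegral.continuous_parametric_primitive_of_continuous (μ := volume)
      (a₀ := (0 : ℝ)) hF2
    have c1 : Continuous fun τ : ℝ => ∫ x in (0 : ℝ)..(a - τ), (-(V x * φ τ x)) ^ 2 :=
      hP.comp (continuous_id.prodMk (continuous_const.sub continuous_id))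
    have c2 : Continuous fun τ : ℝ => ∫ x in (0 : ℝ)..(b + τ), (-(V x * φ τ x)) ^ 2 :=
      hP.comp (continuous_id.prodMk (continuous_const.add continuous_id))
    have heq : (fun τ => ∫ x in (b + τ)..(a - τ), (-(V x * φ τ x)) ^ 2)
        = fun τ => (∫ x in (0 : ℝ)..(a - τ), (-(V x * φ τ x)) ^ 2)
          - ∫ x in (0 : ℝ)..(b + τ), (-(V x * φ τ x)) ^ 2 := by
      funext τ
      have cF : Continuous fun x => (-(V x * φ τ x)) ^ 2 :=
        (hFw_cont.comp (continuous_const.prodMk continuous_id)).pow 2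
      exact (integral_interval_sub_left (cF.intervalIntegrable _ _) (cF.intervalIntegrable _ _)).symm
    rw [heq]; exact c1.sub c2
  have hk : ∀ τ ∈ Icc 0 t, Real.sqrt (∫ x in (b + τ)..(a - τ), (-(V x * φ τ x)) ^ 2)
      ≤ Real.sqrt K * Real.exp (-(μ * τ) / 2) * Real.sqrt EV := fun τ hτ =>
    wave1D_sqrt_source_sq_le hV hV0 hK hμ hVK hφ hφsol hEi hτ.1 (by linarith [hτ.2])
  have hEV0 : 0 ≤ EV := setIntegral_nonneg measurableSet_Iic fun x _ =>
    wave1D_energyDensity_nonneg hV0 0 x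
  calc (∫ τ in (0 : ℝ)..t, Real.sqrt (∫ x in (b + τ)..(a - τ), (-(V x * φ τ x)) ^ 2))
      ≤ ∫ τ in (0 : ℝ)..t, Real.sqrt K * Real.exp (-(μ * τ) / 2) * Real.sqrt EV :=
        intervalIntegral.integral_mono_on ht (hk_cont.intervalIntegrable _ _)
          ((by fun_prop : Continuous fun τ => Real.sqrt K * Real.exp (-(μ * τ) / 2)
            * Real.sqrt EV).intervalIntegrable _ _) hk
    _ = Real.sqrt K * Real.sqrt EV * ∫ τ in (0 : ℝ)..t, Real.exp (-(μ * τ) / 2) := by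
        rw [← intervalIntegral.integral_const_mul]
        refine integral_congr fun τ _ => ?_; ring
    _ ≤ Real.sqrt K * Real.sqrt EV * (2 / μ) :=
        mul_le_mul_of_nonneg_left (integral_exp_neg_half_le hμ t) (by positivity)
    _ = 2 * Real.sqrt K / μ * Real.sqrt EV := by ring

end Source

/-- **`liminf` bookkeeping.** If `E : ℝ → ℝ≥0∞` dominates, for every `t ≥ 0`, `ofReal (X − U t)`
and `U → 0` at `+∞`, then `ofReal X ≤ liminf E atTop`. [folklore] -/
theorem ENNReal.ofReal_le_liminf_of_sub_tendsto_zero {E : ℝ → ENNReal} {U : ℝ → ℝ} {X : ℝ}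
    (hE : ∀ t, 0 ≤ t → ENNReal.ofReal (X - U t) ≤ E t) (hU : Tendsto U atTop (𝓝 0)) :
    ENNReal.ofReal X ≤ liminf E atTop := by
  have hmain : Tendsto (fun t => ENNReal.ofReal (X - U t)) atTop (𝓝 (ENNReal.ofReal X)) := by
    have := hU.const_sub X
    rw [sub_zero] at this
    exact ENNReal.tendsto_ofReal this
  have hev : ∀ᶠ t in atTop, ENNReal.ofReal (X - U t) ≤ E t := by
    filter_upwards [eventually_ge_atTop (0 : ℝ)] with t ht
    exact hE t ht
  calc ENNReal.ofReal X = liminf (fun t => ENNReal.ofReal (X - U t)) atTop := hmain.liminf_eq.symm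
    _ ≤ _ := liminf_le_liminf hev

end Literature.Analysis.PDE
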